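import Literature.NumberTheory.Rogawski1990.ArchExplicitTransferFactorAlongCurve   -- ★ p838769 (F0P3a-p05): the curve′ heads `…_comp_of_isUnit_eval`, `tendsto_…_of_fst_eq_smul_one`
import Literature.NumberTheory.Automorphic.ArchEndoscopicTorusCayleyFrame          -- ★ FILE A (B-p12): Cayley frame of `U(Φ₂)(ℂ)`, `ι(P·diag·P⁻¹, u) ∼ diag`, place-wise `IsConj`
import Literature.NumberTheory.Automorphic.ArchTorusOneAngleCurve                  -- ★ p06: `continuous_torusCurve`, `eventually_injective_splitCurve`
import HarnessLib

/-!
# Rogawski's singular curve `γ(θ, φ, ψ)` LIFTED to the carriers of the archimedean transfer factor: a continuous family of MATCHING PAIRS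
# `ψ ↦ ((g(ψ), u), γ(ψ)) ∈ (U(Φ₂) × U(Φ₁))(L⁺ ⊗ ℝ) × U(diag α)(L⁺ ⊗ ℝ)` through the split-singular `γ₀`, and the curve′ heads of ★ `ArchExplicitTransferFactorAlongCurve` on it

Topic `NumberTheory/Rogawski1990`; namespace `Literature.NumberTheory.Rogawski1990`.  THEOREMS ONLY (no `def`, no named fact, no instance, no notation, no `sorry`;
net debt 0).  Cell `pub/hodgecm-mathlib`, F0∕P3a, topic T6 (#88 side) ∕ road D2′ gap «(V9)-curve-lift» (LEAD F0P3a-plan (g8) WORD T7-35 ∕ T7-45; author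
B-p12 (g27)): the ONE input that makes F0P3a-p05 (g10)'s ★ p838769 `ArchExplicitTransferFactorAlongCurve` (stated for an ARBITRARY family `γc` of matching pairs)
bite at print's curve.  Local algebra in FILE A ★ `Automorphic/ArchEndoscopicTorusCayleyFrame`.  HC_CM is proved only modulo the printed citations until rung 0
closes; nothing printed is asserted here.

THE MATHEMATICS (print §8.2 pp. 122–123).  Fix a CM field `L`, a diagonal form `H′ = diag α` (`α : Fin 3 → L`; the frame of ★ `archDiagTorus` ∕ ★ `archLocal L 3 (diag α) w`
of p06 ∕ B-p17's torus stack), circle data `z₀ : W → Fin 3 → S¹` over the complex places `W` with `z₀,w,0 = z₀,w,2` (the split-singular base point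
`γ₀,w = diag(z₀,w,0, z₀,w,1, z₀,w,0) = γ(θ, φ, 0)`) and weights `c : W → ℝ` (`c ≡ 1`: all places move together; `c = 𝟙_{w₀}`: Rogawski's one-place `ψ`).
The THREE components of the lifted curve are bare terms (no `def`), taken as EQUALITY BINDERS `hγH`, `hγG` (instantiate with `rfl rfl`):
* `G`-side `γG ψ := archDiagTorus L 3 α (fun w i => z₀ w i * Circle.exp (![1, 0, -1] i * (c w * ψ)))` — p06's ★ split curve at parameter `c_w ψ` at every place
  (`map_evalC_archSingularCurveG`);
* `H`-side `γH ψ := (g(ψ), u)` with `w`-components `g_w(ψ) = P · diag(z₀,w,0 e^{ic_wψ}, z₀,w,2 e^{−ic_wψ}) · P⁻¹ ∈ U(Φ₂)(ℂ)` (FILE A's Cayley frame `P = (1 1; 1 −1)`) and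
  `u_w = diag(z₀,w,1) ∈ U(Φ₁)(ℂ)`, assembled by ★ `archPiEquivCM` (`map_evalC_fst∕snd_archSingularCurveH`).
Then: both curves are continuous (`continuous_archSingularCurveH∕G`); **`ι_∞(γH ψ) ↔ γG ψ` for EVERY `ψ`** (`isArchNormPair_archSingularCurve`: at each place
`ι(P·diag(a,b)·P⁻¹, u) = ι(P,1)·diag(a,u,b)·ι(P,1)⁻¹`, FILE A, and conjugacy in `GL₃(L ⊗ ℝ)` is place-wise); at `ψ = 0` the `U(Φ₂)`-block is the SCALAR `e · 1₂`
with `e` its own `(0,0)` entry, `σ_w(e) = z₀,w,0` (`coe_fst_archSingularCurveH_zero`, `evalC_coe_fst_archSingularCurveH_zero`) and `σ_w(u) = z₀,w,1`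
(`evalC_archGammaTwo_archSingularCurveH`); `(G,H)`-REGULARITY at `ψ = 0` ⇔ `z₀,w,0 ≠ z₀,w,1` (`isUnit_eval_archCharpolyTwo_archSingularCurveH_zero`); the `G`-side is
SINGULAR at `ψ = 0` and REGULAR for small `ψ ≠ 0` when every `c_w ≠ 0` (`not_isRegularElt_…_zero`, `eventually_isRegularElt_archSingularCurveG`).  §4 instantiates
p05's heads on the curve: `Δ″_∞` is continuous and non-zero at `ψ = 0`, `Π_w κ_w` has NO jump there, `D_{G∕H,∞} → Π_w |z₀,w,1 − z₀,w,0|²`, and `Δ″_∞` has the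
finite non-zero limit `μ_∞(u)·μ_∞(−(u−e)²e⁻²)⁻¹ · Π_w ‖σ_w(u − e)‖² · Π_w κ_w(0)` — the `|2 sin ψ| = D_H` of p. 123 lives outside `Δ`.
NOT HERE: the class bookkeeping of `γ₀` (★ B-p17 `ArchLocalSingularTorusClasses`: two `U`-classes through it), its centraliser (★ p06
`ArchLocalSplitSingularCentralizer`: `Z(γ₀,w) = ι_w(H_w)`), `D_H(γ(ψ)) = |2 sin ψ|` (★ p06 `norm_coe_splitCurve_zero_sub_two`), generic hermitian `H′` (reached from
`diag α` by ★ frame transport at the end, LEAD T7-45), and the orbital-integral side of the limit formulas.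

## References
* [Rogawski1990] J. D. Rogawski, *Automorphic Representations of Unitary Groups in Three Variables*, Ann. of Math. Stud. 123 (1990): §8.2 Prop. 8.2.1 p. 117–118 and pp. 122–123
  (the compact Cartan `γ(θ, φ, ψ)`, `γ₀ = γ(θ, φ, 0)`, `D_H(γ) = |2 sin ψ|`, `τ(γ)|A₁A₂|`), §8.3 p. 122, §4.8 Case (a) p. 53, §4.9 pp. 54–55, §14.3 p. 234, §14.5 p. 238,
  §14.6 p. 242.
* [Shelstad1979] D. Shelstad, *Characters and inner forms of a quasi-split group over `ℝ`*, Compositio Math. 39 (1979), §4.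
-/

set_option autoImplicit false

noncomputable section

open NumberField NumberField.InfinitePlace Matrix Filter Topology Complex
open scoped MatrixGroups ComplexConjugate

namespace Literature.NumberTheory.Rogawski1990

open Literature.NumberTheory.Automorphic

/-! ## §3 The lifted singular curve `ψ ↦ ((g(ψ), u), γ(ψ))` and its matching -/

section Curve

variable (L : Type) [Field L] [NumberField L] [IsCMField L] (α : Fin 3 → L)
  (z₀ : {w : InfinitePlace L // IsComplex w} → Fin 3 → Circle) (c : {w : InfinitePlace L // IsComplex w} → ℝ)
  (γH : ℝ →
    ↥(UnitaryGroup.arch (↥(maximalRealSubfield L)) L (IsCMField.complexConj L) 2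
        (Matrix.of fun i j : Fin 2 => if i.val + j.val + 1 = 2 then (1 : L) else 0)) ×
      ↥(UnitaryGroup.arch (↥(maximalRealSubfield L)) L (IsCMField.complexConj L) 1
        (Matrix.of fun i j : Fin 1 => if i.val + j.val + 1 = 1 then (1 : L) else 0)))
  (γG : ℝ → ↥(UnitaryGroup.arch (↥(maximalRealSubfield L)) L (IsCMField.complexConj L) 3 (Matrix.diagonal α)))
  (hγH : γH = fun ψ =>
    ((UnitaryGroup.archPiEquivCM 2 L (Matrix.of fun i j : Fin 2 => if i.val + j.val + 1 = 2 then (1 : L) else 0)).symm fun w =>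
        ⟨Matrix.GeneralLinearGroup.mkOfDetNeZero !![(1 : ℂ), 1; 1, -1] UnitaryGroup.det_cayleyTwo_ne_zero *
            UnitaryGroup.circleDiagonal 2 ![z₀ w 0 * Circle.exp (![(1 : ℝ), 0, -1] 0 * (c w * ψ)), z₀ w 2 * Circle.exp (![(1 : ℝ), 0, -1] 2 * (c w * ψ))] *
          (Matrix.GeneralLinearGroup.mkOfDetNeZero !![(1 : ℂ), 1; 1, -1] UnitaryGroup.det_cayleyTwo_ne_zero)⁻¹,
          UnitaryGroup.cayley_conj_circleDiagonal_mem_archLocal L w _⟩,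
      (UnitaryGroup.archPiEquivCM 1 L (Matrix.of fun i j : Fin 1 => if i.val + j.val + 1 = 1 then (1 : L) else 0)).symm fun w =>
        ⟨UnitaryGroup.circleDiagonal 1 ![z₀ w 1 * Circle.exp (![(1 : ℝ), 0, -1] 1 * (c w * ψ))],
          UnitaryGroup.circleDiagonal_mem_archLocal_antidiagOne L w _⟩))
  (hγG : γG = fun ψ => UnitaryGroup.archDiagTorus L 3 α fun w i => z₀ w i * Circle.exp (![(1 : ℝ), 0, -1] i * (c w * ψ)))

/-! ### §3.1 Components at a complex place -/

include hγH in
/-- The `w`-component of the `U(Φ₂)`-block of the lifted `H`-curve: `P · diag(z₀ e^{icψ}, z₀ e^{−icψ}) · P⁻¹`. [cite: Rogawski1990, §8.2 p. 122] -/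
theorem map_evalC_fst_archSingularCurveH (ψ : ℝ) (w : {w : InfinitePlace L // IsComplex w}) :
    Matrix.GeneralLinearGroup.map (UnitaryGroup.evalC L w) (((γH ψ).1 : ↥(UnitaryGroup.arch (↥(maximalRealSubfield L)) L (IsCMField.complexConj L) 2
        (Matrix.of fun i j : Fin 2 => if i.val + j.val + 1 = 2 then (1 : L) else 0))) : GL (Fin 2) (mixedEmbedding.mixedSpace L)) =
      Matrix.GeneralLinearGroup.mkOfDetNeZero !![(1 : ℂ), 1; 1, -1] UnitaryGroup.det_cayleyTwo_ne_zero *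
          UnitaryGroup.circleDiagonal 2 ![z₀ w 0 * Circle.exp (![(1 : ℝ), 0, -1] 0 * (c w * ψ)), z₀ w 2 * Circle.exp (![(1 : ℝ), 0, -1] 2 * (c w * ψ))] *
        (Matrix.GeneralLinearGroup.mkOfDetNeZero !![(1 : ℂ), 1; 1, -1] UnitaryGroup.det_cayleyTwo_ne_zero)⁻¹ := by
  subst hγH
  change (((UnitaryGroup.archPiEquivCM 2 L (Matrix.of fun i j : Fin 2 => if i.val + j.val + 1 = 2 then (1 : L) else 0))
    ((UnitaryGroup.archPiEquivCM 2 L (Matrix.of fun i j : Fin 2 => if i.val + j.val + 1 = 2 then (1 : L) else 0)).symm _) w :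
      ↥(UnitaryGroup.archLocal L 2 (Matrix.of fun i j : Fin 2 => if i.val + j.val + 1 = 2 then (1 : L) else 0) w)) : GL (Fin 2) ℂ) = _
  rw [ContinuousMulEquiv.apply_symm_apply]

include hγH in
/-- The `w`-component of the `U(Φ₁)`-entry of the lifted `H`-curve: `diag(z₀,₁)` (constant in `ψ`). [cite: Rogawski1990, §8.2 p. 122] -/
theorem map_evalC_snd_archSingularCurveH (ψ : ℝ) (w : {w : InfinitePlace L // IsComplex w}) :
    Matrix.GeneralLinearGroup.map (UnitaryGroup.evalC L w) (((γH ψ).2 : ↥(UnitaryGroup.arch (↥(maximalRealSubfield L)) L (IsCMField.complexConj L) 1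
        (Matrix.of fun i j : Fin 1 => if i.val + j.val + 1 = 1 then (1 : L) else 0))) : GL (Fin 1) (mixedEmbedding.mixedSpace L)) =
      UnitaryGroup.circleDiagonal 1 ![z₀ w 1 * Circle.exp (![(1 : ℝ), 0, -1] 1 * (c w * ψ))] := by
  subst hγH
  change (((UnitaryGroup.archPiEquivCM 1 L (Matrix.of fun i j : Fin 1 => if i.val + j.val + 1 = 1 then (1 : L) else 0))
    ((UnitaryGroup.archPiEquivCM 1 L (Matrix.of fun i j : Fin 1 => if i.val + j.val + 1 = 1 then (1 : L) else 0)).symm _) w :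
      ↥(UnitaryGroup.archLocal L 1 (Matrix.of fun i j : Fin 1 => if i.val + j.val + 1 = 1 then (1 : L) else 0) w)) : GL (Fin 1) ℂ) = _
  rw [ContinuousMulEquiv.apply_symm_apply]

include hγG in
/-- The `w`-component of the lifted `G`-curve is p06's split curve `diag(z₀,₀ e^{icψ}, z₀,₁, z₀,₂ e^{−icψ})` (★ `archAt_archDiagTorus`). [cite: Rogawski1990, §8.2 p. 122] -/
theorem map_evalC_archSingularCurveG (ψ : ℝ) (w : {w : InfinitePlace L // IsComplex w}) :
    Matrix.GeneralLinearGroup.map (UnitaryGroup.evalC L w)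
        ((γG ψ : ↥(UnitaryGroup.arch (↥(maximalRealSubfield L)) L (IsCMField.complexConj L) 3 (Matrix.diagonal α))) :
          GL (Fin 3) (mixedEmbedding.mixedSpace L)) =
      UnitaryGroup.circleDiagonal 3 fun i => z₀ w i * Circle.exp (![(1 : ℝ), 0, -1] i * (c w * ψ)) := by
  subst hγG
  exact UnitaryGroup.archAt_archDiagTorus L 3 α _ w

/-! ### §3.2 Continuity, matching, the scalar block at `ψ = 0`, `(G,H)`-regularity there -/

include hγH in
/-- **The lifted `H`-curve is continuous** (★ `archPiEquivCM` is a homeomorphism; `circleDiagonal`, `Circle.exp` continuous). [cite: Rogawski1990, §8.2 p. 122] -/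
theorem continuous_archSingularCurveH : Continuous γH := by
  subst hγH
  refine Continuous.prodMk ?_ ?_
  · refine (UnitaryGroup.archPiEquivCM 2 L _).symm.continuous.comp (continuous_pi fun w => Continuous.subtype_mk ?_ _)
    refine (continuous_const.mul ((UnitaryGroup.continuous_circleDiagonal 2).comp (continuous_pi fun i => ?_))).mul continuous_const
    fin_cases i
    · exact continuous_const.mul (Circle.exp.continuous.comp (continuous_const.mul (continuous_const.mul continuous_id)))
    · exact continuous_const.mul (Circle.exp.continuous.comp (continuous_const.mul (continuous_const.mul continuous_id)))
  · refine (UnitaryGroup.archPiEquivCM 1 L _).symm.continuous.comp (continuous_pi fun w => Continuous.subtype_mk ?_ _)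
    refine (UnitaryGroup.continuous_circleDiagonal 1).comp (continuous_pi fun i => ?_)
    fin_cases i
    exact continuous_const.mul (Circle.exp.continuous.comp (continuous_const.mul (continuous_const.mul continuous_id)))

include hγG in
/-- **The lifted `G`-curve is continuous** (★ `continuous_archDiagTorus`, ★ p06 `continuous_torusCurve`). [cite: Rogawski1990, §8.2 p. 122] -/
theorem continuous_archSingularCurveG : Continuous γG := by
  subst hγG
  refine (UnitaryGroup.continuous_archDiagTorus L 3 α).comp (continuous_pi fun w => ?_)
  exact (continuous_torusCurve (z₀ w) ![(1 : ℝ), 0, -1]).comp (continuous_const.mul continuous_id)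

include hγH hγG in
/-- **THE LIFTED CURVE IS A FAMILY OF MATCHING PAIRS: `ι_∞(g(ψ), u) ↔ γ(ψ)` for EVERY `ψ`** (including the singular parameter `ψ = 0`): at each complex place
`ι(P·diag(a,b)·P⁻¹, u) = ι(P,1) · diag(a, u, b) · ι(P,1)⁻¹` with the CONSTANT conjugator `ι(P, 1)`, and conjugacy in `GL₃(L ⊗ ℝ)` is place-wise.
[cite: Rogawski1990, §8.2 p. 122; §4.9 p. 54; §14.3 p. 234] -/
theorem isArchNormPair_archSingularCurve (ψ : ℝ) : IsArchNormPair L (Matrix.diagonal α) (γH ψ) (γG ψ) := by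
  rw [isArchNormPair_iff]
  unfold Corresponds
  refine UnitaryGroup.isConj_of_forall_isConj_map_evalC L fun w => ?_
  rw [coe_endoEmbArch, map_endoGL, map_evalC_fst_archSingularCurveH L z₀ c γH hγH ψ w, map_evalC_snd_archSingularCurveH L z₀ c γH hγH ψ w,
    map_evalC_archSingularCurveG L α z₀ c γG hγG ψ w]
  convert UnitaryGroup.isConj_endoGL_cayley_conj_circleDiagonal (z₀ w 0 * Circle.exp (![(1 : ℝ), 0, -1] 0 * (c w * ψ)))
    (z₀ w 2 * Circle.exp (![(1 : ℝ), 0, -1] 2 * (c w * ψ))) (z₀ w 1 * Circle.exp (![(1 : ℝ), 0, -1] 1 * (c w * ψ))) using 2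
  funext i; fin_cases i <;> rfl

include hγH in
/-- The `(i, j)` entry of the `U(Φ₂)`-block of `γ_H(ψ)`, read at the complex place `w`, is the entry of `P · diag · P⁻¹`. [cite: Rogawski1990, §8.2 p. 122] -/
theorem snd_coe_fst_archSingularCurveH_apply (ψ : ℝ) (i j : Fin 2) (w : {w : InfinitePlace L // IsComplex w}) :
    (((((γH ψ).1 : ↥(UnitaryGroup.arch (↥(maximalRealSubfield L)) L (IsCMField.complexConj L) 2
        (Matrix.of fun i j : Fin 2 => if i.val + j.val + 1 = 2 then (1 : L) else 0))) : GL (Fin 2) (mixedEmbedding.mixedSpace L)) :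
          Matrix (Fin 2) (Fin 2) (mixedEmbedding.mixedSpace L)) i j).2 w =
      ((Matrix.GeneralLinearGroup.mkOfDetNeZero !![(1 : ℂ), 1; 1, -1] UnitaryGroup.det_cayleyTwo_ne_zero *
          UnitaryGroup.circleDiagonal 2 ![z₀ w 0 * Circle.exp (![(1 : ℝ), 0, -1] 0 * (c w * ψ)), z₀ w 2 * Circle.exp (![(1 : ℝ), 0, -1] 2 * (c w * ψ))] *
        (Matrix.GeneralLinearGroup.mkOfDetNeZero !![(1 : ℂ), 1; 1, -1] UnitaryGroup.det_cayleyTwo_ne_zero)⁻¹ : GL (Fin 2) ℂ) : Matrix (Fin 2) (Fin 2) ℂ) i j := by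
  have h := congrArg (fun g : GL (Fin 2) ℂ => (g : Matrix (Fin 2) (Fin 2) ℂ) i j) (map_evalC_fst_archSingularCurveH L z₀ c γH hγH ψ w)
  exact h

include hγH in
/-- **At `ψ = 0` the `U(Φ₂)`-block of `γ_H` is the SCALAR `e · 1₂`**, `e ∈ L ⊗ ℝ` being (def-free) its own `(0,0)` entry, `σ_w(e) = z₀,w,0` (when `z₀,w,0 = z₀,w,2`):
print's split-singular `γ₀ = γ(θ, φ, 0)` — the hypothesis `h0` of ★ `tendsto_archExplicitDelta_comp_of_fst_eq_smul_one`. [cite: Rogawski1990, §8.2 pp. 122–123] -/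
theorem coe_fst_archSingularCurveH_zero (h02 : ∀ w, z₀ w 0 = z₀ w 2) :
    ((((γH 0).1 : ↥(UnitaryGroup.arch (↥(maximalRealSubfield L)) L (IsCMField.complexConj L) 2
        (Matrix.of fun i j : Fin 2 => if i.val + j.val + 1 = 2 then (1 : L) else 0))) : GL (Fin 2) (mixedEmbedding.mixedSpace L)) :
          Matrix (Fin 2) (Fin 2) (mixedEmbedding.mixedSpace L)) =
      (((((γH 0).1 : ↥(UnitaryGroup.arch (↥(maximalRealSubfield L)) L (IsCMField.complexConj L) 2
        (Matrix.of fun i j : Fin 2 => if i.val + j.val + 1 = 2 then (1 : L) else 0))) : GL (Fin 2) (mixedEmbedding.mixedSpace L)) :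
          Matrix (Fin 2) (Fin 2) (mixedEmbedding.mixedSpace L)) 0 0) • (1 : Matrix (Fin 2) (Fin 2) (mixedEmbedding.mixedSpace L)) := by
  -- the local block at `ψ = 0` is `z₀,w,0 · 1₂`
  have hloc : ∀ w : {w : InfinitePlace L // IsComplex w},
      ((Matrix.GeneralLinearGroup.mkOfDetNeZero !![(1 : ℂ), 1; 1, -1] UnitaryGroup.det_cayleyTwo_ne_zero *
          UnitaryGroup.circleDiagonal 2 ![z₀ w 0 * Circle.exp (![(1 : ℝ), 0, -1] 0 * (c w * 0)), z₀ w 2 * Circle.exp (![(1 : ℝ), 0, -1] 2 * (c w * 0))] *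
        (Matrix.GeneralLinearGroup.mkOfDetNeZero !![(1 : ℂ), 1; 1, -1] UnitaryGroup.det_cayleyTwo_ne_zero)⁻¹ : GL (Fin 2) ℂ) : Matrix (Fin 2) (Fin 2) ℂ) =
        (z₀ w 0 : ℂ) • (1 : Matrix (Fin 2) (Fin 2) ℂ) := fun w => by
    simp only [mul_zero, Circle.exp_zero, mul_one, ← h02 w]
    exact UnitaryGroup.coe_cayley_conj_circleDiagonal_of_eq (z₀ w 0)
  refine Matrix.ext fun i j => ?_
  refine UnitaryGroup.mixedSpace_ext (↥(maximalRealSubfield L)) L (IsCMField.complexConj L) (IsCMField.complexConj_ne_one L)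
    (UnitaryGroup.complexConj_smul_infinitePlace L) fun w => ?_
  rw [Matrix.smul_apply, smul_eq_mul, Prod.snd_mul, Pi.mul_apply, snd_coe_fst_archSingularCurveH_apply L z₀ c γH hγH,
    snd_coe_fst_archSingularCurveH_apply L z₀ c γH hγH, hloc w, Matrix.smul_apply, Matrix.smul_apply, smul_eq_mul, smul_eq_mul,
    Matrix.one_apply_eq, mul_one]
  by_cases hij : i = j
  · subst hij
    rw [Matrix.one_apply_eq, Matrix.one_apply_eq, mul_one, Prod.snd_one, Pi.one_apply, mul_one]
  · rw [Matrix.one_apply_ne hij, Matrix.one_apply_ne hij, mul_zero, Prod.snd_zero, Pi.zero_apply, mul_zero]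

include hγH in
/-- `σ_w(e) = z₀,w,0` for the scalar `e` of ★ `coe_fst_archSingularCurveH_zero` (the `(0,0)` entry at `ψ = 0`; in general it is `(z₀,w,0 + z₀,w,2)∕2`).
[cite: Rogawski1990, §8.2 p. 122] -/
theorem evalC_coe_fst_archSingularCurveH_zero (h02 : ∀ w, z₀ w 0 = z₀ w 2) (w : {w : InfinitePlace L // IsComplex w}) :
    UnitaryGroup.evalC L w (((((γH 0).1 : ↥(UnitaryGroup.arch (↥(maximalRealSubfield L)) L (IsCMField.complexConj L) 2
        (Matrix.of fun i j : Fin 2 => if i.val + j.val + 1 = 2 then (1 : L) else 0))) : GL (Fin 2) (mixedEmbedding.mixedSpace L)) :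
          Matrix (Fin 2) (Fin 2) (mixedEmbedding.mixedSpace L)) 0 0) = z₀ w 0 := by
  rw [UnitaryGroup.evalC_apply, snd_coe_fst_archSingularCurveH_apply L z₀ c γH hγH, UnitaryGroup.coe_cayley_conj_circleDiagonal, ← h02 w]
  simp

include hγH in
/-- **`σ_w(γ₂(ψ)) = z₀,w,1`**: the distinguished eigenvalue `u` of the lifted `H`-curve is CONSTANT (print's `e^{iφ}`). [cite: Rogawski1990, §8.2 p. 122; §4.9 p. 55] -/
theorem evalC_archGammaTwo_archSingularCurveH (ψ : ℝ) (w : {w : InfinitePlace L // IsComplex w}) :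
    UnitaryGroup.evalC L w (archGammaTwo L (γH ψ)) = z₀ w 1 := by
  have h := congrArg (fun g : GL (Fin 1) ℂ => (g : Matrix (Fin 1) (Fin 1) ℂ) 0 0) (map_evalC_snd_archSingularCurveH L z₀ c γH hγH ψ w)
  simp only [UnitaryGroup.coe_circleDiagonal, Matrix.diagonal_apply_eq, Matrix.cons_val_zero] at h
  rw [show ![(1 : ℝ), 0, -1] 1 = 0 from rfl, zero_mul, Circle.exp_zero, mul_one] at h
  exact h

include hγH in
/-- **`(G,H)`-REGULARITY AT `ψ = 0`**: `χ_{g(0)}(u) = (u − e)² ∈ (L ⊗ ℝ)ˣ` iff `z₀,w,1 ≠ z₀,w,0` at every complex place (`u ∉ spec g(0)`; ★ `isUnit_eval_archCharpolyTwo_iff_of_fst_eq_smul_one`)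
— the hypothesis `hu` of the ★ curve′ heads. [cite: Rogawski1990, §8.2 p. 122; §4.9 p. 55] -/
theorem isUnit_eval_archCharpolyTwo_archSingularCurveH_zero (h02 : ∀ w, z₀ w 0 = z₀ w 2) (h01 : ∀ w, z₀ w 0 ≠ z₀ w 1) :
    IsUnit ((archCharpolyTwo L (γH 0)).eval (archGammaTwo L (γH 0))) := by
  rw [isUnit_eval_archCharpolyTwo_iff_of_fst_eq_smul_one L (γH 0) (coe_fst_archSingularCurveH_zero L z₀ c γH hγH h02), Prod.isUnit_iff,
    Pi.isUnit_iff, Pi.isUnit_iff]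
  haveI := UnitaryGroup.isEmpty_isReal (↥(maximalRealSubfield L)) L (IsCMField.complexConj L) (IsCMField.complexConj_ne_one L)
    (UnitaryGroup.complexConj_smul_infinitePlace L)
  refine ⟨fun v => isEmptyElim v, fun w => isUnit_iff_ne_zero.2 ?_⟩
  have h : (archGammaTwo L (γH 0) - ((((γH 0).1 : ↥(UnitaryGroup.arch (↥(maximalRealSubfield L)) L (IsCMField.complexConj L) 2
        (Matrix.of fun i j : Fin 2 => if i.val + j.val + 1 = 2 then (1 : L) else 0))) : GL (Fin 2) (mixedEmbedding.mixedSpace L)) :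
          Matrix (Fin 2) (Fin 2) (mixedEmbedding.mixedSpace L)) 0 0).2 w = (z₀ w 1 : ℂ) - z₀ w 0 := by
    rw [Prod.snd_sub, Pi.sub_apply, ← UnitaryGroup.evalC_apply, ← UnitaryGroup.evalC_apply, evalC_archGammaTwo_archSingularCurveH L z₀ c γH hγH,
      evalC_coe_fst_archSingularCurveH_zero L z₀ c γH hγH h02]
  rw [h, sub_ne_zero, Ne, Circle.coe_inj]
  exact fun e => h01 w e.symm

/-! ### §3.3 Regularity of the `G`-side: singular at `ψ = 0`, regular for small `ψ ≠ 0` -/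

include hγG in
/-- **`γ(0)` is SINGULAR** (not regular semisimple): at every complex place its `{e₁, e₃}` eigenvalues coincide (`z₀,w,0 = z₀,w,2`) — print's `γ₀`, whose class
bookkeeping is ★ B-p17 `ArchLocalSingularTorusClasses` (two classes through it) and whose centraliser is ★ p06 `centralizer_circleDiagonal_eq_range_endoEmb`.
[cite: Rogawski1990, §8.2 p. 122; §8.3 p. 122] -/
theorem not_isRegularElt_archSingularCurveG_zero (h02 : ∀ w, z₀ w 0 = z₀ w 2) :
    ¬ IsRegularElt ((γG 0 : ↥(UnitaryGroup.arch (↥(maximalRealSubfield L)) L (IsCMField.complexConj L) 3 (Matrix.diagonal α))) :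
      GL (Fin 3) (mixedEmbedding.mixedSpace L)) := by
  subst hγG
  rw [UnitaryGroup.isRegularElt_archDiagTorus_iff]
  obtain ⟨v⟩ := (inferInstance : Nonempty (InfinitePlace L))
  haveI := UnitaryGroup.isEmpty_isReal (↥(maximalRealSubfield L)) L (IsCMField.complexConj L) (IsCMField.complexConj_ne_one L)
    (UnitaryGroup.complexConj_smul_infinitePlace L)
  have hv : IsComplex v := not_isReal_iff_isComplex.mp fun h => IsEmpty.false (⟨v, h⟩ : {w : InfinitePlace L // IsReal w})
  intro h
  have h02' := h ⟨v, hv⟩ (a₁ := 0) (a₂ := 2) (by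
    simp only [mul_zero, Circle.exp_zero, mul_one]; exact h02 ⟨v, hv⟩)
  exact absurd h02' (by decide)

include hγG in
/-- **`γ(ψ)` is REGULAR for all small `ψ ≠ 0`** when `z₀,w,0 = z₀,w,2 ≠ z₀,w,1` and every weight `c_w ≠ 0` (★ p06 `eventually_injective_splitCurve` at each place, at parameter
`c_w ψ`; ★ `isRegularElt_archDiagTorus_iff`) — «let `γ` approach `γ₀` through the regular set». [cite: Rogawski1990, §8.2 p. 122; §14.5 p. 238] -/
theorem eventually_isRegularElt_archSingularCurveG (h02 : ∀ w, z₀ w 0 = z₀ w 2) (h01 : ∀ w, z₀ w 0 ≠ z₀ w 1) (hc : ∀ w, c w ≠ 0) :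
    ∀ᶠ ψ in 𝓝[≠] (0 : ℝ), IsRegularElt ((γG ψ : ↥(UnitaryGroup.arch (↥(maximalRealSubfield L)) L (IsCMField.complexConj L) 3 (Matrix.diagonal α))) :
      GL (Fin 3) (mixedEmbedding.mixedSpace L)) := by
  subst hγG
  simp only [UnitaryGroup.isRegularElt_archDiagTorus_iff, Filter.eventually_all]
  intro w
  have ht : Tendsto (fun ψ : ℝ => c w * ψ) (𝓝[≠] 0) (𝓝[≠] 0) := by
    refine tendsto_nhdsWithin_of_tendsto_nhds_of_eventually_within _ ?_ ?_
    · have h : Tendsto (fun ψ : ℝ => c w * ψ) (𝓝 0) (𝓝 (c w * 0)) := tendsto_id.const_mul (c w)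
      rw [mul_zero] at h
      exact h.mono_left nhdsWithin_le_nhds
    · exact eventually_mem_nhdsWithin.mono fun ψ hψ => mul_ne_zero (hc w) hψ
  exact ht.eventually (eventually_injective_splitCurve (z₀ w) (h02 w) (h01 w))

end Curve

/-! ## §4 The curve′ heads of ★ `ArchExplicitTransferFactorAlongCurve` ON the lifted singular curve (`H′ = diag α`, `x₀ = 0`) -/

section AlongCurve

open Literature.NumberTheory.GaloisRepresentations

variable (L : Type) [Field L] [NumberField L] [IsCMField L] (α : Fin 3 → L)
  (z₀ : {w : InfinitePlace L // IsComplex w} → Fin 3 → Circle) (c : {w : InfinitePlace L // IsComplex w} → ℝ)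
  (γH : ℝ →
    ↥(UnitaryGroup.arch (↥(maximalRealSubfield L)) L (IsCMField.complexConj L) 2
        (Matrix.of fun i j : Fin 2 => if i.val + j.val + 1 = 2 then (1 : L) else 0)) ×
      ↥(UnitaryGroup.arch (↥(maximalRealSubfield L)) L (IsCMField.complexConj L) 1
        (Matrix.of fun i j : Fin 1 => if i.val + j.val + 1 = 1 then (1 : L) else 0)))
  (γG : ℝ → ↥(UnitaryGroup.arch (↥(maximalRealSubfield L)) L (IsCMField.complexConj L) 3 (Matrix.diagonal α)))
  (hγH : γH = fun ψ =>
    ((UnitaryGroup.archPiEquivCM 2 L (Matrix.of fun i j : Fin 2 => if i.val + j.val + 1 = 2 then (1 : L) else 0)).symm fun w =>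
        ⟨Matrix.GeneralLinearGroup.mkOfDetNeZero !![(1 : ℂ), 1; 1, -1] UnitaryGroup.det_cayleyTwo_ne_zero *
            UnitaryGroup.circleDiagonal 2 ![z₀ w 0 * Circle.exp (![(1 : ℝ), 0, -1] 0 * (c w * ψ)), z₀ w 2 * Circle.exp (![(1 : ℝ), 0, -1] 2 * (c w * ψ))] *
          (Matrix.GeneralLinearGroup.mkOfDetNeZero !![(1 : ℂ), 1; 1, -1] UnitaryGroup.det_cayleyTwo_ne_zero)⁻¹,
          UnitaryGroup.cayley_conj_circleDiagonal_mem_archLocal L w _⟩,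
      (UnitaryGroup.archPiEquivCM 1 L (Matrix.of fun i j : Fin 1 => if i.val + j.val + 1 = 1 then (1 : L) else 0)).symm fun w =>
        ⟨UnitaryGroup.circleDiagonal 1 ![z₀ w 1 * Circle.exp (![(1 : ℝ), 0, -1] 1 * (c w * ψ))],
          UnitaryGroup.circleDiagonal_mem_archLocal_antidiagOne L w _⟩))
  (hγG : γG = fun ψ => UnitaryGroup.archDiagTorus L 3 α fun w i => z₀ w i * Circle.exp (![(1 : ℝ), 0, -1] i * (c w * ψ)))
  (h02 : ∀ w, z₀ w 0 = z₀ w 2) (h01 : ∀ w, z₀ w 0 ≠ z₀ w 1)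
  (μ : HeckeCharacter L) (hherm : ((Matrix.diagonal α).map (cmConjRingHom L)).transpose = Matrix.diagonal α)
  (hanis : ∀ x : Fin 3 → L, Literature.AlgebraicGeometry.ShimuraVarieties.hermForm (cmConjRingHom L) (Matrix.diagonal α) x x = 0 → x = 0)

include hγH hγG in
/-- The pair curve `ψ ↦ ((g(ψ), u), γ(ψ))` is continuous at `0` (everywhere, in fact). [cite: Rogawski1990, §8.2 p. 122] -/
theorem continuousAt_archSingularCurve_zero : ContinuousAt (fun ψ => (γH ψ, γG ψ)) 0 :=
  ((continuous_archSingularCurveH L z₀ c γH hγH).prodMk (continuous_archSingularCurveG L α z₀ c γG hγG)).continuousAt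

include hγH hγG h02 h01 hherm hanis in
open scoped Classical in
/-- **`Δ″_∞(γ_H(ψ), γ(ψ))` is CONTINUOUS AT `ψ = 0` along the lifted singular curve** (★ `continuousAt_archExplicitDelta_comp_of_isUnit_eval`).
[cite: Rogawski1990, §8.2 pp. 122–123; §14.6 p. 242] -/
theorem continuousAt_archExplicitDelta_archSingularCurve :
    ContinuousAt (fun ψ => archExplicitDelta L (Matrix.diagonal α) (γH ψ) μ (γG ψ)) 0 :=
  continuousAt_archExplicitDelta_comp_of_isUnit_eval L (Matrix.diagonal α) (fun ψ => (γH ψ, γG ψ)) (continuousAt_archSingularCurve_zero L α z₀ c γH γG hγH hγG)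
    μ hherm hanis (isArchNormPair_archSingularCurve L α z₀ c γH γG hγH hγG) (isUnit_eval_archCharpolyTwo_archSingularCurveH_zero L z₀ c γH hγH h02 h01)

include hγH hγG h02 h01 hherm hanis in
/-- **`Δ″_∞(γ_H(ψ), γ(ψ)) ≠ 0` for `ψ` near `0`** along the lifted singular curve (★ `eventually_archExplicitDelta_comp_ne_zero`). [cite: Rogawski1990, §8.2 Prop. 8.2.1 p. 117, pp. 122–123] -/
theorem eventually_archExplicitDelta_archSingularCurve_ne_zero :
    ∀ᶠ ψ in 𝓝 (0 : ℝ), archExplicitDelta L (Matrix.diagonal α) (γH ψ) μ (γG ψ) ≠ 0 :=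
  eventually_archExplicitDelta_comp_ne_zero L (Matrix.diagonal α) (fun ψ => (γH ψ, γG ψ)) (continuousAt_archSingularCurve_zero L α z₀ c γH γG hγH hγG)
    μ hherm hanis (isArchNormPair_archSingularCurve L α z₀ c γH γG hγH hγG) (isUnit_eval_archCharpolyTwo_archSingularCurveH_zero L z₀ c γH hγH h02 h01)

include hγH hγG h02 h01 hherm hanis in
open scoped Classical in
/-- **NO JUMP of `Π_w κ_w` at `ψ = 0`** along the lifted singular curve (★ `eventually_prod_archKappaAt_comp_eq_of_isUnit_eval`): print's `±1` at `γ₀` are the Kottwitz signs of the two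
limit classes, not a discontinuity of `κ`. [cite: Rogawski1990, §8.2 p. 122; §14.6 p. 242] -/
theorem eventually_prod_archKappaAt_archSingularCurve_eq :
    ∀ᶠ ψ in 𝓝 (0 : ℝ),
      (∏ w : {w : InfinitePlace L // IsComplex w}, archKappaAt L (Matrix.diagonal α) (γH ψ) w (γG ψ)) =
        ∏ w : {w : InfinitePlace L // IsComplex w}, archKappaAt L (Matrix.diagonal α) (γH 0) w (γG 0) :=
  eventually_prod_archKappaAt_comp_eq_of_isUnit_eval L (Matrix.diagonal α) (fun ψ => (γH ψ, γG ψ))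
    (continuousAt_archSingularCurve_zero L α z₀ c γH γG hγH hγG) hherm hanis (isArchNormPair_archSingularCurve L α z₀ c γH γG hγH hγG 0)
    (isUnit_eval_archCharpolyTwo_archSingularCurveH_zero L z₀ c γH hγH h02 h01)

include hγH hγG h02 in
open scoped Classical in
/-- **`D_{G∕H,∞}(γ_H(ψ)) → Π_w ‖σ_w(u − e)‖²`** as `ψ → 0` along the lifted singular curve, `e` = the scalar of `g(0)` (★ `tendsto_archWeylRatio_comp_of_fst_eq_smul_one`); by
★ `evalC_archGammaTwo_archSingularCurveH` ∕ ★ `evalC_coe_fst_archSingularCurveH_zero` the limit is `Π_w |z₀,w,1 − z₀,w,0|²` (print: `|e^{iφ} − e^{iθ}|²` per place, NOT `0`).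
[cite: Rogawski1990, §8.2 pp. 122–123; §4.9 p. 55] -/
theorem tendsto_archWeylRatio_archSingularCurve :
    Tendsto (fun ψ => archWeylRatio L (γH ψ)) (𝓝 0)
      (𝓝 (∏ w : {w : InfinitePlace L // IsComplex w}, ‖UnitaryGroup.evalC L w (archGammaTwo L (γH 0) -
        ((((γH 0).1 : ↥(UnitaryGroup.arch (↥(maximalRealSubfield L)) L (IsCMField.complexConj L) 2
          (Matrix.of fun i j : Fin 2 => if i.val + j.val + 1 = 2 then (1 : L) else 0))) : GL (Fin 2) (mixedEmbedding.mixedSpace L)) :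
            Matrix (Fin 2) (Fin 2) (mixedEmbedding.mixedSpace L)) 0 0)‖ ^ 2)) :=
  tendsto_archWeylRatio_comp_of_fst_eq_smul_one L (Matrix.diagonal α) (fun ψ => (γH ψ, γG ψ)) (continuousAt_archSingularCurve_zero L α z₀ c γH γG hγH hγG)
    (coe_fst_archSingularCurveH_zero L z₀ c γH hγH h02)

include hγH h02 in
open scoped Classical in
/-- The limit of `D_{G∕H,∞}` read in the circle data: `Π_w ‖σ_w(u − e)‖² = Π_w ‖z₀,w,1 − z₀,w,0‖²`. [cite: Rogawski1990, §8.2 p. 123] -/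
theorem prod_norm_evalC_archGammaTwo_sub_sq_eq :
    (∏ w : {w : InfinitePlace L // IsComplex w}, ‖UnitaryGroup.evalC L w (archGammaTwo L (γH 0) -
        ((((γH 0).1 : ↥(UnitaryGroup.arch (↥(maximalRealSubfield L)) L (IsCMField.complexConj L) 2
          (Matrix.of fun i j : Fin 2 => if i.val + j.val + 1 = 2 then (1 : L) else 0))) : GL (Fin 2) (mixedEmbedding.mixedSpace L)) :
            Matrix (Fin 2) (Fin 2) (mixedEmbedding.mixedSpace L)) 0 0)‖ ^ 2) =
      ∏ w : {w : InfinitePlace L // IsComplex w}, ‖(z₀ w 1 : ℂ) - z₀ w 0‖ ^ 2 := by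
  refine Finset.prod_congr rfl fun w _ => ?_
  rw [map_sub, evalC_archGammaTwo_archSingularCurveH L z₀ c γH hγH, evalC_coe_fst_archSingularCurveH_zero L z₀ c γH hγH h02]

include hγH hγG h02 h01 hherm hanis in
open scoped Classical in
/-- **`Δ″_∞(γ_H(ψ), γ(ψ))` HAS A FINITE NON-ZERO LIMIT AT `ψ = 0`** along the lifted singular curve: `→ μ_∞(u)·μ_∞(−(u−e)²e⁻²)⁻¹ · Π_w ‖σ_w(u − e)‖² · Π_w κ_w(0)`
(★ `tendsto_archExplicitDelta_comp_of_fst_eq_smul_one`; `e` = the scalar of `g(0)`, `σ_w(e) = z₀,w,0`, `σ_w(u) = z₀,w,1`). The `|2 sin ψ|` of p. 123 is `D_H`, outside `Δ`.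
[cite: Rogawski1990, §8.2 pp. 122–123; §14.6 p. 242] -/
theorem tendsto_archExplicitDelta_archSingularCurve :
    Tendsto (fun ψ => archExplicitDelta L (Matrix.diagonal α) (γH ψ) μ (γG ψ)) (𝓝 0)
      (𝓝 (archHeckeValue L μ (archGammaTwo L (γH 0)) *
            (archHeckeValue L μ (-((archGammaTwo L (γH 0) -
              ((((γH 0).1 : ↥(UnitaryGroup.arch (↥(maximalRealSubfield L)) L (IsCMField.complexConj L) 2
                (Matrix.of fun i j : Fin 2 => if i.val + j.val + 1 = 2 then (1 : L) else 0))) : GL (Fin 2) (mixedEmbedding.mixedSpace L)) :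
                  Matrix (Fin 2) (Fin 2) (mixedEmbedding.mixedSpace L)) 0 0) ^ 2) *
              (((((γH 0).1 : ↥(UnitaryGroup.arch (↥(maximalRealSubfield L)) L (IsCMField.complexConj L) 2
                (Matrix.of fun i j : Fin 2 => if i.val + j.val + 1 = 2 then (1 : L) else 0))) : GL (Fin 2) (mixedEmbedding.mixedSpace L)) :
                  Matrix (Fin 2) (Fin 2) (mixedEmbedding.mixedSpace L)) 0 0 ^ 2)⁻¹))⁻¹ *
          ((∏ w : {w : InfinitePlace L // IsComplex w}, ‖UnitaryGroup.evalC L w (archGammaTwo L (γH 0) -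
            ((((γH 0).1 : ↥(UnitaryGroup.arch (↥(maximalRealSubfield L)) L (IsCMField.complexConj L) 2
              (Matrix.of fun i j : Fin 2 => if i.val + j.val + 1 = 2 then (1 : L) else 0))) : GL (Fin 2) (mixedEmbedding.mixedSpace L)) :
                Matrix (Fin 2) (Fin 2) (mixedEmbedding.mixedSpace L)) 0 0)‖ ^ 2 : ℝ) : ℂ) *
          ((∏ w : {w : InfinitePlace L // IsComplex w}, archKappaAt L (Matrix.diagonal α) (γH 0) w (γG 0) : ℤ) : ℂ))) :=
  tendsto_archExplicitDelta_comp_of_fst_eq_smul_one L (Matrix.diagonal α) (fun ψ => (γH ψ, γG ψ)) (continuousAt_archSingularCurve_zero L α z₀ c γH γG hγH hγG)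
    μ hherm hanis (isArchNormPair_archSingularCurve L α z₀ c γH γG hγH hγG) (coe_fst_archSingularCurveH_zero L z₀ c γH hγH h02)
    (isUnit_eval_archCharpolyTwo_archSingularCurveH_zero L z₀ c γH hγH h02 h01)

end AlongCurve

end Literature.NumberTheory.Rogawski1990

end
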